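import Summits.MatrixMultiplication.OmegaCensus.STPPVosperSlackTwoChain
import Summits.MatrixMultiplication.OmegaCensus.STPPVosperSlackOneTwoRuns

/-!
# ω-census (abelian STPP census): the SLACK-2 case split at prime order — trichotomy, Vosper / Hamidoune–Rødseth / two-run shapes (kernel)

HONEST FRAMING (pub-omega census; verbatim): lottery ticket; floor = certified bounds/negative ranges.
Census STRUCTURE (seat pub-omega-stpp-1 gen 32, 2026-08-28), family (b2).  The per-case SHAPE LEMMAS of the slack-2 partition law (HOME
`pub-omega-stpp-1-g32/SLACK2-DESIGN.md`; python ×1 pilot: kit GO #110 / #111), over the dual chain `STPPVosperSlackTwoChain.lean`.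
`C`-reading of block `i` of an STPP family in `ℤ/pℤ` (all sets non-empty, `N ≥ 2`): `W = {c − a − b}` (`#W = vol = aᵢbᵢcᵢ`), `SY = (−Aᵢ) + Y°`,
`T = (−Bᵢ) + Z°`, `Y° = ⋃_{k≠i}(C_k − B_k)` (`L` points), `Z° = ⋃_{k≠i}(C_k − A_k)` (`z` points), `a = #Aᵢ`, `b = #Bᵢ`; SLACK 2 means
`z + b + vol + a + L = p` (tight is `= p + 2`, slack 1 is `= p + 1`).

* `disjoint_negA_add_DU_negB_add_DU`, `W_subset_sdiff_SY_union_T`, `card_sdiff_add_card_SY_add_card_T` (any finite abelian group): `SY ⊥ T`,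
  `W ⊆ R := H ∖ (SY ∪ T)` and `#R + #SY + #T = #H`;
* `card_add_sum_le_card_negA_add_DU`, `card_add_sum_le_card_negB_add_DU` (Cauchy–Davenport): `a + L ≤ #SY + 1`, `b + z ≤ #T + 1`;
* `card_sdiff_SY_union_T_le_of_slack` : at slack `s`, `#R ≤ vol + s` — the premise of the exact-cover-with-holes test (`coverByFk_blockSum2`,
  `STPPVosperSlackPairingHoles.lean`, seat stpp-2 gen 26) with `k = s`;
* `slack_two_trichotomy` : at slack 2 exactly one of  (A) `#SY = a + L − 1` (then `#T ≤ b + z + 1`),  (B′) `#T = b + z − 1` (then `#SY ≤ a + L + 1`),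
  (C) `#SY = a + L`, `#T = b + z` and `W ⊔ SY ⊔ T = ℤ/pℤ`;
* `slack_two_shapes` : with `a, b, z, L ≥ 2`, Vosper turns (A) into "`Aᵢ` and `Y°` are progressions with a common difference" and (B′) into "`Bᵢ` and
  `Z°` are progressions with a common difference" — NO third inverse theorem is needed on the other pair (the pilot's case B′ enumerates it);
* `slack_two_caseC_HR_A`, `slack_two_caseC_HR_B` : in case (C), Hamidoune–Rødseth (`HamidouneRodsethInverseTheorem`, a tree theorem —
  `hamidouneRodsethInverseTheorem_holds`) puts `Aᵢ ⊆` an `(a+1)`-progression and `Y° ⊆` an `(L+1)`-progression of the same non-zero difference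
  (`a, L ≥ 3`, `a + L ≥ 7`), resp. the same for `(Bᵢ, Z°)`;
* `slack_two_caseC_twoRuns_A`, `slack_two_caseC_twoRuns_B` : in case (C) with a TWO-element `Aᵢ = {α₁, α₂}` (resp. `Bᵢ`), `Y°` (resp. `Z°`) is the
  union of two progressions of difference `α₁ − α₂` (elementary, `two_runs_of_card_union_vadd`) — the ℤ₅₉ leaves `{223,342²}`, `{233,234,323}`.
* §3 (glue to `coverByFk_blockSum2`): `exists_image_zero_sub_eq_range_image_of_isAP` (a progression side in index-set form, `AD = range #S`),
  `eq_image_indexSet` + `indexSet_lt` (an ARBITRARY side in index-set form — case (A)'s `Bᵢ`, case (B′)'s `Aᵢ`), `range_lt_of_le`.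
UNCONDITIONAL (the H–R lemmas take the named fact as a hypothesis, discharged by `hamidouneRodsethInverseTheorem_holds`).  Nothing here is progress on `ω`.

References: A. G. Vosper, J. London Math. Soc. 31 (1956); Y. O. Hamidoune, Ø. J. Rødseth, Acta Arith. 92 (2000); H. Cohn, R. Kleinberg, B. Szegedy,
C. Umans, FOCS 2005 (arXiv:math/0511460), Def. 5.1.
-/

open Finset
open scoped Pointwise

namespace Summit.MatrixMultiplication.OmegaCensus.CubeNB

open Literature.Computability.AlgebraicComplexity
open Literature.Combinatorics.Additive
open Summit.MatrixMultiplication.OmegaCensus.STPPKneser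

/-! ## §1 The fourth set `R = H ∖ (SY ∪ T)` -/

section General

variable {H : Type*} [AddCommGroup H] [DecidableEq H] [Fintype H] {N : ℕ} {A B C : Fin N → Finset H}

/-- `SY = (−Aᵢ) + Y°` and `T = (−Bᵢ) + Z°` are disjoint. [cite: CohnKleinbergSzegedyUmans2005, Def. 5.1] -/
theorem disjoint_negA_add_DU_negB_add_DU (hS : IsSTPP A B C) (i : Fin N) :
    Disjoint ((A i).image (fun a => (0 : H) - a) + DU B C (univ.erase i)) ((B i).image (fun b => (0 : H) - b) + DU A C (univ.erase i)) :=
  ((disjoint_negB_add_DU_AC hS i).mono_right Finset.subset_union_right).symm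

/-- `W ⊆ R = H ∖ (SY ∪ T)`. [cite: CohnKleinbergSzegedyUmans2005, Def. 5.1] -/
theorem W_subset_sdiff_SY_union_T (hS : IsSTPP A B C) (i : Fin N) :
    (((A i) ×ˢ ((B i) ×ˢ (C i))).image fun q : H × H × H => (0 : H) + q.2.2 - q.1 - q.2.1) ⊆
      univ \ (((A i).image (fun a => (0 : H) - a) + DU B C (univ.erase i)) ∪ ((B i).image (fun b => (0 : H) - b) + DU A C (univ.erase i))) := by
  intro w hw
  rw [Finset.mem_sdiff, Finset.mem_union, not_or]
  exact ⟨Finset.mem_univ w, fun h => Finset.disjoint_left.1 (disjoint_W_negA_add_DU hS i) hw h,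
    fun h => Finset.disjoint_left.1 (disjoint_negB_add_DU_AC hS i) h (Finset.mem_union_left _ hw)⟩

/-- `#R + #SY + #T = #H`. [folklore] -/
theorem card_sdiff_add_card_SY_add_card_T (hS : IsSTPP A B C) (i : Fin N) :
    #(univ \ (((A i).image (fun a => (0 : H) - a) + DU B C (univ.erase i)) ∪ ((B i).image (fun b => (0 : H) - b) + DU A C (univ.erase i)))) +
      #((A i).image (fun a => (0 : H) - a) + DU B C (univ.erase i)) + #((B i).image (fun b => (0 : H) - b) + DU A C (univ.erase i)) =
      Fintype.card H := by
  have hd := Finset.card_union_of_disjoint (disjoint_negA_add_DU_negB_add_DU hS i)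
  have hle := Finset.card_le_univ
    (((A i).image (fun a => (0 : H) - a) + DU B C (univ.erase i)) ∪ ((B i).image (fun b => (0 : H) - b) + DU A C (univ.erase i)))
  rw [Finset.card_sdiff_of_subset (Finset.subset_univ _), Finset.card_univ]
  omega

end General

/-! ## §2 Prime order: Cauchy–Davenport on both pairs, the trichotomy, the shapes -/

section Prime

variable {p : ℕ} [hp : Fact p.Prime] {N : ℕ} {A B C : Fin N → Finset (ZMod p)}

/-- Cauchy–Davenport for `(−Aᵢ, Y°)`: `a + L ≤ #SY + 1` (`SY` misses the non-empty set `W`). [cite: Vosper1956, main theorem; Nathanson1996, Thm 2.7] -/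
theorem card_add_sum_le_card_negA_add_DU (hS : IsSTPP A B C) (hA : ∀ k, (A k).Nonempty) (hB : ∀ k, (B k).Nonempty)
    (hC : ∀ k, (C k).Nonempty) (i : Fin N) (hI : ((univ : Finset (Fin N)).erase i).Nonempty) :
    #(A i) + ∑ k ∈ univ.erase i, #(B k) * #(C k) ≤ #((A i).image (fun x => (0 : ZMod p) - x) + DU B C (univ.erase i)) + 1 := by
  set W := ((A i) ×ˢ ((B i) ×ˢ (C i))).image fun q : ZMod p × ZMod p × ZMod p => (0 : ZMod p) + q.2.2 - q.1 - q.2.1 with hW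
  set S := (A i).image (fun x => (0 : ZMod p) - x) with hSdef
  set Yo := DU B C (univ.erase i) with hYo
  have hScard : #S = #(A i) := Finset.card_image_of_injective _ sub_right_injective
  have hYcard : #Yo = ∑ k ∈ univ.erase i, #(B k) * #(C k) := card_DU_BC hS hA _
  have hSne : S.Nonempty := (hA i).image _
  have hYne : Yo.Nonempty := DU_nonempty hI hB hC
  have hWcard : #W = #(A i) * #(B i) * #(C i) := card_image_blockSum hS i 0
  have hWne : W.Nonempty :=
    Finset.card_pos.1 (by rw [hWcard]; exact Nat.mul_pos (Nat.mul_pos (hA i).card_pos (hB i).card_pos) (hC i).card_pos)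
  have hne : S + Yo ≠ univ := by
    intro h
    obtain ⟨w, hw⟩ := hWne
    exact Finset.disjoint_left.1 (disjoint_W_negA_add_DU hS i) hw (h ▸ Finset.mem_univ w)
  have hcd := Vosper.cauchy_davenport_of_ne_univ hSne hYne hne
  rw [hScard, hYcard] at hcd
  exact hcd

/-- Cauchy–Davenport for `(−Bᵢ, Z°)`: `b + z ≤ #T + 1` (`T` misses the non-empty set `W`). [cite: Vosper1956, main theorem; Nathanson1996, Thm 2.7] -/
theorem card_add_sum_le_card_negB_add_DU (hS : IsSTPP A B C) (hA : ∀ k, (A k).Nonempty) (hB : ∀ k, (B k).Nonempty)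
    (hC : ∀ k, (C k).Nonempty) (i : Fin N) (hI : ((univ : Finset (Fin N)).erase i).Nonempty) :
    #(B i) + ∑ k ∈ univ.erase i, #(A k) * #(C k) ≤ #((B i).image (fun x => (0 : ZMod p) - x) + DU A C (univ.erase i)) + 1 := by
  set W := ((A i) ×ˢ ((B i) ×ˢ (C i))).image fun q : ZMod p × ZMod p × ZMod p => (0 : ZMod p) + q.2.2 - q.1 - q.2.1 with hW
  set Tn := (B i).image (fun x => (0 : ZMod p) - x) with hTdef
  set Zo := DU A C (univ.erase i) with hZo
  have hTcard : #Tn = #(B i) := Finset.card_image_of_injective _ sub_right_injective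
  have hZcard : #Zo = ∑ k ∈ univ.erase i, #(A k) * #(C k) := card_DU_AC hS hB _
  have hTne : Tn.Nonempty := (hB i).image _
  have hZne : Zo.Nonempty := DU_nonempty hI hA hC
  have hWcard : #W = #(A i) * #(B i) * #(C i) := card_image_blockSum hS i 0
  have hWne : W.Nonempty :=
    Finset.card_pos.1 (by rw [hWcard]; exact Nat.mul_pos (Nat.mul_pos (hA i).card_pos (hB i).card_pos) (hC i).card_pos)
  have hne : Tn + Zo ≠ univ := by
    intro h
    obtain ⟨w, hw⟩ := hWne
    exact Finset.disjoint_left.1 (disjoint_negB_add_DU_AC hS i) (h ▸ Finset.mem_univ w) (Finset.mem_union_left _ hw)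
  have hcd := Vosper.cauchy_davenport_of_ne_univ hTne hZne hne
  rw [hTcard, hZcard] at hcd
  exact hcd

/-- **`#R ≤ vol + s` at slack `s`** (`z + b + vol + a + L + s = p + 2`, `vol = aᵢbᵢcᵢ = #W`): the set `R = ℤ/pℤ ∖ (SY ∪ T) ⊇ W` has at most `s` points
outside `W`.
[cite: CohnKleinbergSzegedyUmans2005, Def. 5.1] [cite: Vosper1956, main theorem; Nathanson1996, Thm 2.7] -/
theorem card_sdiff_SY_union_T_le_of_slack (hS : IsSTPP A B C) (hA : ∀ k, (A k).Nonempty) (hB : ∀ k, (B k).Nonempty)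
    (hC : ∀ k, (C k).Nonempty) (i : Fin N) (hI : ((univ : Finset (Fin N)).erase i).Nonempty) {a b vol z L s : ℕ}
    (ha : #(A i) = a) (hb : #(B i) = b)
    (hz : ∑ k ∈ univ.erase i, #(A k) * #(C k) = z) (hL : ∑ k ∈ univ.erase i, #(B k) * #(C k) = L) (hslack : z + b + vol + a + L + s = p + 2) :
    #(univ \ (((A i).image (fun x => (0 : ZMod p) - x) + DU B C (univ.erase i)) ∪ ((B i).image (fun x => (0 : ZMod p) - x) + DU A C (univ.erase i)))) ≤
      vol + s := by
  have h1 := card_add_sum_le_card_negA_add_DU hS hA hB hC i hI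
  have h2 := card_add_sum_le_card_negB_add_DU hS hA hB hC i hI
  have h3 := card_sdiff_add_card_SY_add_card_T hS i
  rw [ha, hL] at h1
  rw [hb, hz] at h2
  rw [ZMod.card] at h3
  omega

/-- **The slack-2 trichotomy.**  At slack 2 (`z + b + vol + a + L = p`): (A) `#SY = a + L − 1` and `#T ≤ b + z + 1`, or (B′) `#T = b + z − 1` and
`#SY ≤ a + L + 1`, or (C) `#SY = a + L`, `#T = b + z` and `W ∪ SY ∪ T = ℤ/pℤ` (a partition, the three sets being pairwise disjoint).
[cite: CohnKleinbergSzegedyUmans2005, Def. 5.1] [cite: Vosper1956, main theorem; Nathanson1996, Thm 2.7] -/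
theorem slack_two_trichotomy (hS : IsSTPP A B C) (hA : ∀ k, (A k).Nonempty) (hB : ∀ k, (B k).Nonempty) (hC : ∀ k, (C k).Nonempty)
    (i : Fin N) (hI : ((univ : Finset (Fin N)).erase i).Nonempty) {a b vol z L : ℕ}
    (ha : #(A i) = a) (hb : #(B i) = b) (hvol : #(A i) * #(B i) * #(C i) = vol)
    (hz : ∑ k ∈ univ.erase i, #(A k) * #(C k) = z) (hL : ∑ k ∈ univ.erase i, #(B k) * #(C k) = L) (hslack : z + b + vol + a + L = p) :
    (#((A i).image (fun x => (0 : ZMod p) - x) + DU B C (univ.erase i)) = a + L - 1 ∧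
        #((B i).image (fun x => (0 : ZMod p) - x) + DU A C (univ.erase i)) ≤ b + z + 1) ∨
      (#((B i).image (fun x => (0 : ZMod p) - x) + DU A C (univ.erase i)) = b + z - 1 ∧
        #((A i).image (fun x => (0 : ZMod p) - x) + DU B C (univ.erase i)) ≤ a + L + 1) ∨
      (#((A i).image (fun x => (0 : ZMod p) - x) + DU B C (univ.erase i)) = a + L ∧
        #((B i).image (fun x => (0 : ZMod p) - x) + DU A C (univ.erase i)) = b + z ∧
        (((A i) ×ˢ ((B i) ×ˢ (C i))).image fun q : ZMod p × ZMod p × ZMod p => (0 : ZMod p) + q.2.2 - q.1 - q.2.1) ∪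
            ((A i).image (fun x => (0 : ZMod p) - x) + DU B C (univ.erase i)) ∪
            ((B i).image (fun x => (0 : ZMod p) - x) + DU A C (univ.erase i)) = univ) := by
  have h1 := card_add_sum_le_card_negA_add_DU hS hA hB hC i hI
  have h2 := card_add_sum_le_card_negB_add_DU hS hA hB hC i hI
  have h3 := card_W_add_card_SY_add_card_T_le hS i
  rw [ha, hL] at h1
  rw [hb, hz] at h2
  rw [card_image_blockSum hS i 0, hvol, ZMod.card] at h3
  by_cases hA1 : #((A i).image (fun x => (0 : ZMod p) - x) + DU B C (univ.erase i)) = a + L - 1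
  · exact Or.inl ⟨hA1, by omega⟩
  by_cases hB1 : #((B i).image (fun x => (0 : ZMod p) - x) + DU A C (univ.erase i)) = b + z - 1
  · exact Or.inr (Or.inl ⟨hB1, by omega⟩)
  have hSY : #((A i).image (fun x => (0 : ZMod p) - x) + DU B C (univ.erase i)) = a + L := by omega
  have hT : #((B i).image (fun x => (0 : ZMod p) - x) + DU A C (univ.erase i)) = b + z := by omega
  refine Or.inr (Or.inr ⟨hSY, hT, union_eq_univ_of_card hS i ?_⟩)
  rw [card_image_blockSum hS i 0, hvol, ZMod.card, hSY, hT]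
  omega

/-- **The slack-2 shapes (Vosper on the critical pair).**  At slack 2 with `a, b, z, L ≥ 2`: (A) `Aᵢ` and `Y°` are arithmetic progressions with a
common non-zero difference (`#SY = a + L − 1`, `#T ≤ b + z + 1`), or (B′) `Bᵢ` and `Z°` are (`#T = b + z − 1`, `#SY ≤ a + L + 1`), or (C) both pairs
are exactly one above Cauchy–Davenport and `W ⊔ SY ⊔ T = ℤ/pℤ`. [cite: Vosper1956, main theorem; Nathanson1996, Thm 2.7]
[cite: CohnKleinbergSzegedyUmans2005, Def. 5.1] -/
theorem slack_two_shapes (hS : IsSTPP A B C) (hA : ∀ k, (A k).Nonempty) (hB : ∀ k, (B k).Nonempty) (hC : ∀ k, (C k).Nonempty)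
    (i : Fin N) (hI : ((univ : Finset (Fin N)).erase i).Nonempty) {a b vol z L : ℕ}
    (ha : #(A i) = a) (hb : #(B i) = b) (hvol : #(A i) * #(B i) * #(C i) = vol)
    (hz : ∑ k ∈ univ.erase i, #(A k) * #(C k) = z) (hL : ∑ k ∈ univ.erase i, #(B k) * #(C k) = L) (hslack : z + b + vol + a + L = p)
    (h2a : 2 ≤ a) (h2b : 2 ≤ b) (h2z : 2 ≤ z) (h2L : 2 ≤ L) :
    (∃ d : ZMod p, d ≠ 0 ∧ IsAP (A i) d ∧ IsAP (DU B C (univ.erase i)) d ∧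
        #((A i).image (fun x => (0 : ZMod p) - x) + DU B C (univ.erase i)) = a + L - 1 ∧
        #((B i).image (fun x => (0 : ZMod p) - x) + DU A C (univ.erase i)) ≤ b + z + 1) ∨
      (∃ e : ZMod p, e ≠ 0 ∧ IsAP (B i) e ∧ IsAP (DU A C (univ.erase i)) e ∧
        #((B i).image (fun x => (0 : ZMod p) - x) + DU A C (univ.erase i)) = b + z - 1 ∧
        #((A i).image (fun x => (0 : ZMod p) - x) + DU B C (univ.erase i)) ≤ a + L + 1) ∨
      (#((A i).image (fun x => (0 : ZMod p) - x) + DU B C (univ.erase i)) = a + L ∧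
        #((B i).image (fun x => (0 : ZMod p) - x) + DU A C (univ.erase i)) = b + z ∧
        (((A i) ×ˢ ((B i) ×ˢ (C i))).image fun q : ZMod p × ZMod p × ZMod p => (0 : ZMod p) + q.2.2 - q.1 - q.2.1) ∪
            ((A i).image (fun x => (0 : ZMod p) - x) + DU B C (univ.erase i)) ∪
            ((B i).image (fun x => (0 : ZMod p) - x) + DU A C (univ.erase i)) = univ) := by
  have hScard : #((A i).image fun x => (0 : ZMod p) - x) = a := by rw [Finset.card_image_of_injective _ sub_right_injective, ha]
  have hTcard : #((B i).image fun x => (0 : ZMod p) - x) = b := by rw [Finset.card_image_of_injective _ sub_right_injective, hb]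
  have hYcard : #(DU B C (univ.erase i)) = L := by rw [card_DU_BC hS hA, hL]
  have hZcard : #(DU A C (univ.erase i)) = z := by rw [card_DU_AC hS hB, hz]
  rcases slack_two_trichotomy hS hA hB hC i hI ha hb hvol hz hL hslack with ⟨hSY, hT⟩ | ⟨hT, hSY⟩ | h3
  · obtain ⟨d, hd, hSap, hYap⟩ := vosper_inverse (A := (A i).image fun x => (0 : ZMod p) - x) (B := DU B C (univ.erase i))
      (by rw [hScard]; exact h2a) (by rw [hYcard]; exact h2L) (by rw [hScard, hYcard, hSY]) (by rw [hSY]; omega)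
    have hAap : IsAP (A i) d := by
      have h := hSap.neg
      rwa [image_zero_sub_eq_neg, neg_neg] at h
    exact Or.inl ⟨d, hd, hAap, hYap, hSY, hT⟩
  · obtain ⟨e, he, hTap, hZap⟩ := vosper_inverse (A := (B i).image fun x => (0 : ZMod p) - x) (B := DU A C (univ.erase i))
      (by rw [hTcard]; exact h2b) (by rw [hZcard]; exact h2z) (by rw [hTcard, hZcard, hT]) (by rw [hT]; omega)
    have hBap : IsAP (B i) e := by
      have h := hTap.neg
      rwa [image_zero_sub_eq_neg, neg_neg] at h
    exact Or.inr (Or.inl ⟨e, he, hBap, hZap, hT, hSY⟩)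
  · exact Or.inr (Or.inr h3)

/-- From `−X ⊆ {s + i•d : i ≤ n}`: `X ⊆ {(−s − n•d) + i•d : i ≤ n}`. [cite: Nathanson1996, §2.5 (proof of Lemma 2.7)] -/
theorem subset_apFinset_of_image_zero_sub_subset {X : Finset (ZMod p)} {s d : ZMod p} {n : ℕ}
    (h : X.image (fun x => (0 : ZMod p) - x) ⊆ apFinset s d (n + 1)) : X ⊆ apFinset (-s - n • d) d (n + 1) := by
  intro x hx
  have hnx : (0 : ZMod p) - x ∈ apFinset s d (n + 1) := h (Finset.mem_image_of_mem _ hx)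
  rw [← neg_apFinset, Finset.mem_neg']
  rwa [zero_sub] at hnx

/-- **Case (C), pair `(−Aᵢ, Y°)`, by Hamidoune–Rødseth** (`a, L ≥ 3`, `a + L ≥ 7`; `#SY = a + L ≤ p − 4` is automatic at slack 2 since `vol ≥ 3`):
`Aᵢ` lies in an `(a+1)`-term progression and `Y°` in an `(L+1)`-term progression with the same non-zero difference.
[cite: HamidouneRodseth2000, main theorem (§1, p. 252); SerraZemor2000, Theorem 3] [cite: CohnKleinbergSzegedyUmans2005, Def. 5.1] -/
theorem slack_two_caseC_HR_A (hHR : HamidouneRodsethInverseTheorem) (hS : IsSTPP A B C) (hA : ∀ k, (A k).Nonempty)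
    (hB : ∀ k, (B k).Nonempty) (hC : ∀ k, (C k).Nonempty) (i : Fin N) {a b vol z L : ℕ}
    (ha : #(A i) = a) (hb : #(B i) = b) (hvol : #(A i) * #(B i) * #(C i) = vol)
    (hz : ∑ k ∈ univ.erase i, #(A k) * #(C k) = z) (hL : ∑ k ∈ univ.erase i, #(B k) * #(C k) = L) (hslack : z + b + vol + a + L = p)
    (h3a : 3 ≤ a) (h3L : 3 ≤ L) (h7 : 7 ≤ a + L)
    (hSY : #((A i).image (fun x => (0 : ZMod p) - x) + DU B C (univ.erase i)) = a + L) :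
    ∃ d s t : ZMod p, d ≠ 0 ∧ A i ⊆ apFinset s d (a + 1) ∧ DU B C (univ.erase i) ⊆ apFinset t d (L + 1) := by
  have hScard : #((A i).image fun x => (0 : ZMod p) - x) = a := by rw [Finset.card_image_of_injective _ sub_right_injective, ha]
  have hYcard : #(DU B C (univ.erase i)) = L := by rw [card_DU_BC hS hA, hL]
  have hb1 : 1 ≤ #(B i) := (hB i).card_pos
  have hc1 : 1 ≤ #(C i) := (hC i).card_pos
  have h3vol : a * 1 * 1 ≤ #(A i) * #(B i) * #(C i) := by rw [ha]; exact Nat.mul_le_mul (Nat.mul_le_mul le_rfl hb1) hc1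
  rw [mul_one, mul_one, hvol] at h3vol
  obtain ⟨d, s, t, hSsub, hYsub⟩ := hHR p ((A i).image fun x => (0 : ZMod p) - x) (DU B C (univ.erase i))
    (by rw [hScard]; exact h3a) (by rw [hYcard]; exact h3L) (by rw [hSY]; exact h7) (by rw [hSY]; omega) (by rw [hSY, hScard, hYcard])
  rw [hScard] at hSsub
  rw [hYcard] at hYsub
  exact ⟨d, -s - a • d, t, step_ne_zero_of_subset_apFinset hSsub (by rw [hScard]; omega), subset_apFinset_of_image_zero_sub_subset hSsub, hYsub⟩

/-- **Case (C), pair `(−Bᵢ, Z°)`, by Hamidoune–Rødseth** (`b, z ≥ 3`, `b + z ≥ 7`): `Bᵢ` lies in a `(b+1)`-term progression and `Z°` in a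
`(z+1)`-term progression with the same non-zero difference.
[cite: HamidouneRodseth2000, main theorem (§1, p. 252); SerraZemor2000, Theorem 3] [cite: CohnKleinbergSzegedyUmans2005, Def. 5.1] -/
theorem slack_two_caseC_HR_B (hHR : HamidouneRodsethInverseTheorem) (hS : IsSTPP A B C) (hA : ∀ k, (A k).Nonempty)
    (hB : ∀ k, (B k).Nonempty) (hC : ∀ k, (C k).Nonempty) (i : Fin N) {a b vol z L : ℕ}
    (ha : #(A i) = a) (hb : #(B i) = b) (hvol : #(A i) * #(B i) * #(C i) = vol)
    (hz : ∑ k ∈ univ.erase i, #(A k) * #(C k) = z) (hL : ∑ k ∈ univ.erase i, #(B k) * #(C k) = L) (hslack : z + b + vol + a + L = p)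
    (h3b : 3 ≤ b) (h3z : 3 ≤ z) (h7 : 7 ≤ b + z)
    (hT : #((B i).image (fun x => (0 : ZMod p) - x) + DU A C (univ.erase i)) = b + z) :
    ∃ e s t : ZMod p, e ≠ 0 ∧ B i ⊆ apFinset s e (b + 1) ∧ DU A C (univ.erase i) ⊆ apFinset t e (z + 1) := by
  have hTcard : #((B i).image fun x => (0 : ZMod p) - x) = b := by rw [Finset.card_image_of_injective _ sub_right_injective, hb]
  have hZcard : #(DU A C (univ.erase i)) = z := by rw [card_DU_AC hS hB, hz]
  have ha1 : 1 ≤ #(A i) := (hA i).card_pos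
  have hc1 : 1 ≤ #(C i) := (hC i).card_pos
  have h3vol : 1 * b * 1 ≤ #(A i) * #(B i) * #(C i) := by rw [hb]; exact Nat.mul_le_mul (Nat.mul_le_mul ha1 le_rfl) hc1
  rw [one_mul, mul_one, hvol] at h3vol
  obtain ⟨e, s, t, hTsub, hZsub⟩ := hHR p ((B i).image fun x => (0 : ZMod p) - x) (DU A C (univ.erase i))
    (by rw [hTcard]; exact h3b) (by rw [hZcard]; exact h3z) (by rw [hT]; exact h7) (by rw [hT]; omega) (by rw [hT, hTcard, hZcard])
  rw [hTcard] at hTsub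
  rw [hZcard] at hZsub
  exact ⟨e, -s - b • e, t, step_ne_zero_of_subset_apFinset hTsub (by rw [hTcard]; omega), subset_apFinset_of_image_zero_sub_subset hTsub, hZsub⟩

/-- **Two runs from a two-element set.**  If `#X = 2`, `X = {x₁, x₂}`-free form: `#((−X) + Y) = #Y + 2` forces `Y` to be the union of two
progressions of difference `x₁ − x₂` for ANY enumeration `X = {x₁, x₂}`. [folklore] -/
theorem two_runs_of_card_negPair_add {X Y : Finset (ZMod p)} {x₁ x₂ : ZMod p} (hX : X = {x₁, x₂}) (hne : x₁ ≠ x₂)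
    (hcard : #(X.image (fun x => (0 : ZMod p) - x) + Y) = #Y + 2) :
    ∃ c₁ c₂ : ZMod p, ∃ ℓ₁ ℓ₂ : ℕ, 1 ≤ ℓ₁ ∧ ℓ₁ ≤ ℓ₂ ∧ ℓ₁ + ℓ₂ = #Y ∧ Y = apFinset c₁ (x₁ - x₂) ℓ₁ ∪ apFinset c₂ (x₁ - x₂) ℓ₂ := by
  have hSnE : X.image (fun x => (0 : ZMod p) - x) = {(0 : ZMod p) - x₁, ((0 : ZMod p) - x₁) + (x₁ - x₂)} := by
    rw [hX, Finset.image_insert, Finset.image_singleton]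
    congr 1
    rw [show (0 : ZMod p) - x₁ + (x₁ - x₂) = 0 - x₂ by abel]
  have hs0 : x₁ - x₂ ≠ 0 := fun h => hne (by linear_combination h)
  have hSYeq : X.image (fun x => (0 : ZMod p) - x) + Y = ((0 : ZMod p) - x₁) +ᵥ (Y ∪ ((x₁ - x₂) +ᵥ Y)) := by
    rw [hSnE]; exact pair_add_eq_vadd_union _ _ Y
  have hUcard : #(Y ∪ ((x₁ - x₂) +ᵥ Y)) = #Y + 2 := by
    have h := congrArg Finset.card hSYeq
    rw [Finset.card_vadd_finset] at h
    rw [← h, hcard]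
  exact two_runs_of_card_union_vadd hs0 hUcard

/-- **Case (C), pair `(−Aᵢ, Y°)` with `a = 2`**: if `Aᵢ = {α₁, α₂}` and `#SY = L + 2`, then `Y°` is the union of two progressions of difference
`α₁ − α₂` with `ℓ₁ + ℓ₂ = L` terms, `1 ≤ ℓ₁ ≤ ℓ₂`. [folklore] [cite: CohnKleinbergSzegedyUmans2005, Def. 5.1] -/
theorem slack_two_caseC_twoRuns_A (hS : IsSTPP A B C) (hA : ∀ k, (A k).Nonempty) (i : Fin N) {L : ℕ} {α₁ α₂ : ZMod p}
    (hAi : A i = {α₁, α₂}) (hne : α₁ ≠ α₂) (hL : ∑ k ∈ univ.erase i, #(B k) * #(C k) = L)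
    (hSY : #((A i).image (fun x => (0 : ZMod p) - x) + DU B C (univ.erase i)) = L + 2) :
    ∃ c₁ c₂ : ZMod p, ∃ ℓ₁ ℓ₂ : ℕ, 1 ≤ ℓ₁ ∧ ℓ₁ ≤ ℓ₂ ∧ ℓ₁ + ℓ₂ = L ∧
      DU B C (univ.erase i) = apFinset c₁ (α₁ - α₂) ℓ₁ ∪ apFinset c₂ (α₁ - α₂) ℓ₂ := by
  have hYcard : #(DU B C (univ.erase i)) = L := by rw [card_DU_BC hS hA, hL]
  rw [← hYcard] at hSY ⊢
  exact two_runs_of_card_negPair_add hAi hne hSY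

/-- **Case (C), pair `(−Bᵢ, Z°)` with `b = 2`**: if `Bᵢ = {β₁, β₂}` and `#T = z + 2`, then `Z°` is the union of two progressions of difference
`β₁ − β₂` with `ℓ₁ + ℓ₂ = z` terms, `1 ≤ ℓ₁ ≤ ℓ₂`. [folklore] [cite: CohnKleinbergSzegedyUmans2005, Def. 5.1] -/
theorem slack_two_caseC_twoRuns_B (hS : IsSTPP A B C) (hB : ∀ k, (B k).Nonempty) (i : Fin N) {z : ℕ} {β₁ β₂ : ZMod p}
    (hBi : B i = {β₁, β₂}) (hne : β₁ ≠ β₂) (hz : ∑ k ∈ univ.erase i, #(A k) * #(C k) = z)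
    (hT : #((B i).image (fun x => (0 : ZMod p) - x) + DU A C (univ.erase i)) = z + 2) :
    ∃ c₁ c₂ : ZMod p, ∃ ℓ₁ ℓ₂ : ℕ, 1 ≤ ℓ₁ ∧ ℓ₁ ≤ ℓ₂ ∧ ℓ₁ + ℓ₂ = z ∧
      DU A C (univ.erase i) = apFinset c₁ (β₁ - β₂) ℓ₁ ∪ apFinset c₂ (β₁ - β₂) ℓ₂ := by
  have hZcard : #(DU A C (univ.erase i)) = z := by rw [card_DU_AC hS hB, hz]
  rw [← hZcard] at hT ⊢
  exact two_runs_of_card_negPair_add hBi hne hT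

end Prime

/-! ## §3 Glue to the exact-cover-with-holes test (`coverByFk_blockSum2`): index-set forms of `−Aᵢ` and of an arbitrary `Bᵢ` -/

section Glue

variable {p : ℕ} [hp : Fact p.Prime]

/-- **Index-set form of a progression side.**  If `S` is a progression of difference `d` (`IsAP S d`, `S ≠ ∅`) then `−S`, written as the image
`S.image (0 − ·)`, is `{s₀ + ε•d : ε < #S}` for some `s₀` — the hypothesis `hSn` of `coverByFk_blockSum2` with `AD = range #S`.
[cite: Nathanson1996, §2.5 (proof of Lemma 2.7)] -/
theorem exists_image_zero_sub_eq_range_image_of_isAP {S : Finset (ZMod p)} {d : ZMod p} (h : IsAP S d) (hS : S.Nonempty) :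
    ∃ s₀ : ZMod p, S.image (fun x => (0 : ZMod p) - x) = (range #S).image fun ε : ℕ => s₀ + ε • d := by
  obtain ⟨α, hα⟩ := h
  obtain ⟨n, hn⟩ : ∃ n, #S = n + 1 := ⟨#S - 1, by have := hS.card_pos; omega⟩
  rw [hn] at hα
  refine ⟨-α - n • d, ?_⟩
  rw [hn, image_zero_sub_eq_neg, hα, neg_apFinset]
  rfl

/-- **Index-set form of an arbitrary set.**  For `u·e′ = 1` and any base point `β`, every `S ⊆ ℤ/pℤ` is `{β + δ•e′ : δ ∈ BD}` with
`BD = {((x − β)·u).val : x ∈ S}` — the hypothesis `hB` of `coverByFk_blockSum2` for a side on which NO structure is known (case (A): `Bᵢ`; case (B′): `Aᵢ`).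
[folklore] -/
theorem eq_image_indexSet (S : Finset (ZMod p)) (β : ZMod p) {u e' : ZMod p} (hue : u * e' = 1) :
    S = (S.image fun x => ((x - β) * u).val).image fun δ : ℕ => β + δ • e' := by
  have hid : ∀ x : ZMod p, β + ((x - β) * u).val • e' = x := fun x => by
    rw [nsmul_eq_mul, ZMod.natCast_zmod_val]
    linear_combination (x - β) * hue
  ext x
  rw [Finset.image_image, Finset.mem_image]
  constructor
  · intro hx
    exact ⟨x, hx, hid x⟩
  · rintro ⟨y, hy, rfl⟩
    show β + ((y - β) * u).val • e' ∈ S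
    rw [hid y]
    exact hy

/-- The index set of `eq_image_indexSet` lies below `p`. [folklore] -/
theorem indexSet_lt (S : Finset (ZMod p)) (β u : ZMod p) : ∀ δ ∈ S.image (fun x => ((x - β) * u).val), δ < p := by
  intro δ hδ
  obtain ⟨x, _, rfl⟩ := Finset.mem_image.1 hδ
  exact ZMod.val_lt _

omit hp in
/-- `range n` lies below `p` once `n ≤ p`. [folklore] -/
theorem range_lt_of_le {n : ℕ} (hn : n ≤ p) : ∀ ε ∈ range n, ε < p := fun _ hε => lt_of_lt_of_le (Finset.mem_range.1 hε) hn

end Glue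

end Summit.MatrixMultiplication.OmegaCensus.CubeNB
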